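import Literature.Analysis.PDE.FrozenSymbolCoefficients
import Literature.Analysis.PDE.SchauderInteriorBallHolder
import Literature.Analysis.Calculus.SegmentFDerivIntegral
import Literature.Analysis.Calculus.IteratedFDerivFromPartials
import Literature.Analysis.FunctionSpaces.HolderBallLimit
import Mathlib.Analysis.SpecialFunctions.Pow.Continuity
import HarnessLib

/-!
# Difference-quotient regularity for fully nonlinear elliptic equations: `C^{2,α} ⇒ C^{3,α}`

Topic `Literature/Analysis/PDE`. The first step of the REGULARITY half of Gilbarg–Trudinger
(2001), Lemma 17.16: let `H : P × CJet ι 2 → ℝ` be a smooth structure function of a parameter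
`p ∈ P` and a coordinate `2`-jet (`Literature/Analysis/Calculus/CoordinateJets.lean`), let
`c : E → P` be `C^{1,α}` and `v ∈ C^{2,α}` a solution of

  `H(c(y), cjet₂ v(y)) = 0` on the ball `B(x₀, R)`,

with quantitative bounds `Bc`, `Bv`, and suppose `DH` is uniformly elliptic on rank-one top-slot
jets in a `δ`-neighbourhood of the graph `{(c(y), cjet₂ v(y))}`. Then `v ∈ C^{3,α}(B(x₀, ρ))`
for every `ρ < R`, with bounds (`contDiffOn_three_and_bounds_of_holderTwo_solution`).

Proof (Gilbarg–Trudinger, §17.4; Nirenberg's difference-quotient method). Fix a unit vector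
`e` (a basis direction `e_k`), a step `h` and a smaller ball `B(x₀, R')`, `|h| ≤ R - R'`; write
`w(y) = (c(y), cjet₂ v(y))` and

  `𝒜ₕ(y) = ∫₀¹ DH(w(y) + t (w(y + h e) - w(y))) dt : P × CJet ι 2 →L[ℝ] ℝ`

(the functional frozen along the segment,
`Literature/Analysis/Calculus/SegmentFDerivIntegral.lean`), `v_h = Δₕᵉ v`, `c_h = Δₕᵉ c`
(difference quotients, `Literature/Analysis/Calculus/DifferenceQuotientHolder.lean`).
Subtracting the equation at `y` from the equation at `y + h e` gives
`𝒜ₕ(y) (c_h(y), cjet₂ v_h(y)) = 0` (`frozen_equation`), i.e. for `v_h` the LINEAR equation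
`∑ ãₕᵃᵇ D²v_h(e_a, e_b) = f_h` with the frozen symbol coefficients of `𝒜ₕ(y)`
(`Literature/Analysis/PDE/FrozenSymbolCoefficients.lean`). With constants UNIFORM in `h`:

* `dataMap_holder_mapsTo` — `w` is `α`-Hölder on `B(x₀, R)` and takes values in the compact
  convex box `B̄(0, Bc) × B̄(0, Bv)`;
* `frozen_functional_data` — for `|h| < h₁`: `‖𝒜ₕ(y)‖ ≤ M_A`, `y ↦ 𝒜ₕ(y)` is `α`-Hölder with
  constant `K_A` on `B(x₀, R')`, and `𝒜ₕ(y)` is `λ`-elliptic on rank-one top-slot jets (the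
  segment stays in the `δ`-neighbourhood of the graph where `DH` is elliptic, and lower bounds
  along the segment integrate, `le_segmentFDerivIntegral_apply`);
* `diffQuot_coeff_data`, `diffQuot_unknown_data` — the `C^α` data of `c_h` and the `C^{1,α}` data
  of `v_h` (sup and Hölder bounds of `v_h`, `Dv_h`, `cjet₁ v_h`), the `C²` smoothness of `v_h`
  and an (`h`-dependent) Hölder bound of `D²v_h`.

Since `v_h` is genuinely `C^{2,α}`, the interior Schauder estimate for `C^{2,α}` functions
(`Literature.Analysis.PDE.exists_schauder_interior_ball_of_holder`, Gilbarg–Trudinger Cor. 6.3)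
then bounds `D²v_h` in `C^α(B(x₀, ρ))` uniformly in `h` (`diffQuot_schauder_bounds`). Letting
`h → 0` along a sequence, `v_h → ∂_k v` pointwise and the uniform `C^{2,α}` bounds pass to the
limit (`Literature.Analysis.FunctionSpaces.contDiffOn_ball_and_bounds_of_tendsto_of_holderOnWith`,
Arzelà–Ascoli; `holderTwo_fderiv_apply_basis`). Finally `C^{2,α}` bounds for all partial
derivatives `∂_k v` are `C^{3,α}` bounds for `v`
(`Literature.Analysis.Calculus.contDiffOn_succ_and_bounds_of_partials`).

Everything is proved; no definitions, no named facts. Not here: the induction to `C^∞`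
(differentiate the equation, which needs `c ∈ C^{m+1,α}`), and the a-priori `C^{2,α}` estimate
of Evans–Krylov producing the hypotheses.

## References

* D. Gilbarg, N. S. Trudinger, *Elliptic Partial Differential Equations of Second Order*,
  Classics in Mathematics, Springer 2001, Lemma 17.16 (regularity part of the proof, §17.4)
  and Cor. 6.3. [GilbargTrudinger2001]
-/

noncomputable section

open scoped ContDiff Topology NNReal
open Set Function Metric Filter
open Literature.Analysis.Calculus Literature.Analysis.FunctionSpaces

namespace Literature.Analysis.PDE

section UniformData

variable {ι : Type*} [Fintype ι] [DecidableEq ι] {E : Type*} [NormedAddCommGroup E]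
  [InnerProductSpace ℝ E]
variable {P : Type*} [NormedAddCommGroup P] [NormedSpace ℝ P]

/-! ### The data map `w = (c, cjet₂ v)` -/

section DataMap

omit [DecidableEq ι] in
/-- **Hölder bound of the lower derivatives from derivative bounds**: if `u ∈ C²(B(x₀, R))` with
`‖Dʲu‖ ≤ B` for `j ≤ 2` and `[D²u]_α ≤ B` on the ball (`α ≤ 1`), then every `Dʲu`, `j ≤ 2`, is
`α`-Hölder there with constant `max (B (2R)^{1-α}) B` (the lower ones are Lipschitz).
[folklore] -/
theorem holderOnWith_iteratedFDeriv_of_le_two {α : ℝ≥0} (hα1 : α ≤ 1) {u : E → ℝ} {x₀ : E}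
    {R : ℝ} {B : ℝ≥0} (hu : ContDiffOn ℝ 2 u (ball x₀ R))
    (hB : ∀ y ∈ ball x₀ R, ∀ j ≤ 2, ‖iteratedFDeriv ℝ j u y‖ ≤ B)
    (hH : HolderOnWith B α (iteratedFDeriv ℝ 2 u) (ball x₀ R)) :
    ∀ j ≤ 2, HolderOnWith (max (B * (2 * R.toNNReal) ^ (1 - (α : ℝ))) B) α
      (iteratedFDeriv ℝ j u) (ball x₀ R) := by
  -- adapted from the proof of `Literature.Analysis.PDE.holderOnWith_jetMap`
  intro j hj
  rcases hj.lt_or_eq with hlt | rfl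
  · refine (holderOnWith_of_norm_fderiv_le_ball hα1 (fun z hz => ?_) (fun z hz => ?_)).mono_const
      (le_max_left _ _)
    · have huz : ContDiffAt ℝ 2 u z := hu.contDiffAt (isOpen_ball.mem_nhds hz)
      exact (huz.differentiableAt_iteratedFDeriv (by exact_mod_cast hlt)).differentiableWithinAt
    · rw [norm_fderiv_iteratedFDeriv]
      exact hB z hz (j + 1) hlt
  · exact hH.mono_const (le_max_right _ _)

omit [DecidableEq ι] in
/-- **The data map is Hölder and takes values in a compact box.** For `c ∈ C¹(B(x₀, R))` with
`‖Dʲc‖ ≤ Bc` (`j ≤ 1`) and `v ∈ C²(B(x₀, R))` with `‖Dʲv‖ ≤ Bv` (`j ≤ 2`), `[D²v]_α ≤ Bv`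
(`α ≤ 1`): `w = (c, cjet₂ v)` is `α`-Hölder on the ball with constant
`max (Bc (2R)^{1-α}) (max (Bv (2R)^{1-α}) Bv)`, maps the ball into `B̄(0, Bc) × B̄(0, Bv)`, and
`cjet₂ v` is `α`-Hölder with constant `max (Bv (2R)^{1-α}) Bv`. [folklore] -/
theorem dataMap_holder_mapsTo (bE : OrthonormalBasis ι ℝ E) {α : ℝ≥0} (hα1 : α ≤ 1) {c : E → P}
    {v : E → ℝ} {x₀ : E} {R : ℝ} {Bc Bv : ℝ≥0} (hc : ContDiffOn ℝ 1 c (ball x₀ R))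
    (hBc : ∀ y ∈ ball x₀ R, ∀ j ≤ 1, ‖iteratedFDeriv ℝ j c y‖ ≤ Bc)
    (hv : ContDiffOn ℝ 2 v (ball x₀ R))
    (hBv : ∀ y ∈ ball x₀ R, ∀ j ≤ 2, ‖iteratedFDeriv ℝ j v y‖ ≤ Bv)
    (hHv : HolderOnWith Bv α (iteratedFDeriv ℝ 2 v) (ball x₀ R)) :
    HolderOnWith (max (Bc * (2 * R.toNNReal) ^ (1 - (α : ℝ)))
        (max (Bv * (2 * R.toNNReal) ^ (1 - (α : ℝ))) Bv)) α
      (fun y => (c y, cjetOf bE 2 v y)) (ball x₀ R) ∧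
    MapsTo (fun y => (c y, cjetOf bE 2 v y)) (ball x₀ R)
      (closedBall (0 : P) Bc ×ˢ closedBall (0 : CJet ι 2) Bv) ∧
    HolderOnWith (max (Bv * (2 * R.toNNReal) ^ (1 - (α : ℝ))) Bv) α (cjetOf bE 2 v)
      (ball x₀ R) := by
  have hJ : HolderOnWith (max (Bv * (2 * R.toNNReal) ^ (1 - (α : ℝ))) Bv) α (cjetOf bE 2 v)
      (ball x₀ R) :=
    holderOnWith_cjetOf bE 2 v (holderOnWith_iteratedFDeriv_of_le_two hα1 hv hBv hHv)
  have hcH : HolderOnWith (Bc * (2 * R.toNNReal) ^ (1 - (α : ℝ))) α c (ball x₀ R) :=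
    holderOnWith_of_norm_fderiv_le_ball hα1 (hc.differentiableOn one_ne_zero) fun z hz => by
      rw [← norm_iteratedFDeriv_one]; exact hBc z hz 1 le_rfl
  refine ⟨hcH.prodMk hJ, fun y hy => ⟨?_, ?_⟩, hJ⟩
  · have h0 := hBc y hy 0 zero_le_one
    rw [norm_iteratedFDeriv_zero] at h0
    exact mem_closedBall_zero_iff.2 h0
  · exact mem_closedBall_zero_iff.2 (norm_cjetOf_le bE 2 v y (hBv y hy) Bv.coe_nonneg)

end DataMap

/-! ### The difference quotients of the coefficients and of the unknown -/

section DiffQuot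

omit [Fintype ι] [DecidableEq ι] [InnerProductSpace ℝ E] in
/-- **`C^α` data of the difference quotients of the coefficients, uniformly in `h`.** For
`c ∈ C¹(B(x₀, R))` with `‖Dʲc‖ ≤ Bc` (`j ≤ 1`), `[Dc]_α ≤ Bc`, a unit vector `e` and
`|h| ≤ R - R'`: on `B(x₀, R')`, `‖Δₕᵉ c‖ ≤ Bc`, `[Δₕᵉ c]_α ≤ Bc`, and
`‖c(y + h e) - c(y)‖ ≤ Bc |h|`. [folklore] -/
theorem diffQuot_coeff_data [NormedSpace ℝ E] {α : ℝ≥0} {c : E → P} {x₀ : E} {R R' h : ℝ}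
    {Bc : ℝ≥0} (hc : ContDiffOn ℝ 1 c (ball x₀ R))
    (hBc : ∀ y ∈ ball x₀ R, ∀ j ≤ 1, ‖iteratedFDeriv ℝ j c y‖ ≤ Bc)
    (hHc : HolderOnWith Bc α (iteratedFDeriv ℝ 1 c) (ball x₀ R)) {e : E} (he : ‖e‖ = 1)
    (hh : |h| ≤ R - R') :
    (∀ y ∈ ball x₀ R', ‖h⁻¹ • (c (y + h • e) - c y)‖ ≤ Bc) ∧
    HolderOnWith Bc α (fun y => h⁻¹ • (c (y + h • e) - c y)) (ball x₀ R') ∧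
    ∀ y ∈ ball x₀ R', ‖c (y + h • e) - c y‖ ≤ Bc * |h| := by
  have hhe : ‖h • e‖ ≤ R - R' := by rwa [norm_smul, he, mul_one, Real.norm_eq_abs]
  have hcd : DifferentiableOn ℝ c (ball x₀ R) := hc.differentiableOn one_ne_zero
  have hDc : ∀ x ∈ ball x₀ R, ‖fderiv ℝ c x‖ ≤ Bc := fun x hx => by
    rw [← norm_iteratedFDeriv_one]; exact hBc x hx 1 le_rfl
  have hHc' : HolderOnWith Bc α (fderiv ℝ c) (ball x₀ R) :=
    holderOnWith_fderiv_of_iteratedFDeriv_one hHc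
  have he1 : ‖e‖₊ = 1 := by rw [← NNReal.coe_inj, coe_nnnorm, he, NNReal.coe_one]
  refine ⟨fun y hy => ?_, ?_, fun y hy => ?_⟩
  · simpa only [he, mul_one] using norm_diffQuot_le hcd hDc hhe hy
  · simpa only [he1, mul_one] using holderOnWith_diffQuot hcd hHc' hhe
  · have h1 := norm_comp_add_sub_le hcd hDc hhe hy
    rwa [norm_smul, he, Real.norm_eq_abs, mul_one] at h1

omit [DecidableEq ι] in
/-- **`C^{1,α}` data of the difference quotients of the unknown, uniformly in `h`, and their
`C^{2,α}` regularity.** For `v ∈ C²(B(x₀, R))` with `‖Dʲv‖ ≤ Bv` (`j ≤ 2`), `[D²v]_α ≤ Bv`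
(`α ≤ 1`), a unit vector `e` and `|h| ≤ R - R'`, the difference quotient `v_h = Δₕᵉ v` satisfies
on `B(x₀, R')`: `v_h ∈ C²`; `‖Dʲ v_h‖ ≤ Bv` for `j ≤ 1` (also as `|v_h|, ‖Dv_h‖ ≤ Bv`);
`[Dv_h]_α ≤ Bv`; `‖cjet₁ v_h‖ ≤ Bv` and `[cjet₁ v_h]_α ≤ max (Bv (2R')^{1-α}) Bv`; and
`[D²v_h]_α ≤ |h|⁻¹ (Bv + Bv)` (an `h`-dependent bound, which only certifies `v_h ∈ C^{2,α}`).
(Gilbarg–Trudinger 2001, §17.4.) [folklore] -/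
theorem diffQuot_unknown_data (bE : OrthonormalBasis ι ℝ E) {α : ℝ≥0} (hα1 : α ≤ 1) {v : E → ℝ}
    {x₀ : E} {R R' h : ℝ} {Bv : ℝ≥0} (hv : ContDiffOn ℝ 2 v (ball x₀ R))
    (hBv : ∀ y ∈ ball x₀ R, ∀ j ≤ 2, ‖iteratedFDeriv ℝ j v y‖ ≤ Bv)
    (hHv : HolderOnWith Bv α (iteratedFDeriv ℝ 2 v) (ball x₀ R)) {e : E} (he : ‖e‖ = 1)
    (hh : |h| ≤ R - R') :
    ContDiffOn ℝ 2 (fun y => h⁻¹ • (v (y + h • e) - v y)) (ball x₀ R') ∧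
    (∀ y ∈ ball x₀ R', ∀ j ≤ 1,
      ‖iteratedFDeriv ℝ j (fun y => h⁻¹ • (v (y + h • e) - v y)) y‖ ≤ Bv) ∧
    (∀ y ∈ ball x₀ R', ‖h⁻¹ • (v (y + h • e) - v y)‖ ≤ Bv) ∧
    (∀ y ∈ ball x₀ R', ‖fderiv ℝ (fun y => h⁻¹ • (v (y + h • e) - v y)) y‖ ≤ Bv) ∧
    HolderOnWith Bv α (fderiv ℝ (fun y => h⁻¹ • (v (y + h • e) - v y))) (ball x₀ R') ∧
    (∀ y ∈ ball x₀ R', ‖cjetOf bE 1 (fun y => h⁻¹ • (v (y + h • e) - v y)) y‖ ≤ Bv) ∧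
    HolderOnWith (max (Bv * (2 * R'.toNNReal) ^ (1 - (α : ℝ))) Bv) α
      (cjetOf bE 1 (fun y => h⁻¹ • (v (y + h • e) - v y))) (ball x₀ R') ∧
    HolderOnWith (‖h⁻¹‖₊ * (Bv + Bv)) α
      (iteratedFDeriv ℝ 2 (fun y => h⁻¹ • (v (y + h • e) - v y))) (ball x₀ R') := by
  have hhe : ‖h • e‖ ≤ R - R' := by rwa [norm_smul, he, mul_one, Real.norm_eq_abs]
  have hRR' : R' ≤ R := sub_nonneg.1 ((abs_nonneg h).trans hh)
  have he1 : ‖e‖₊ = 1 := by rw [← NNReal.coe_inj, coe_nnnorm, he, NNReal.coe_one]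
  -- the data of `v` in terms of `fderiv`
  have hvd : DifferentiableOn ℝ v (ball x₀ R) := hv.differentiableOn two_ne_zero
  have hfv : ContDiffOn ℝ 1 (fderiv ℝ v) (ball x₀ R) :=
    hv.fderiv_of_isOpen isOpen_ball (by norm_num)
  have hfvd : DifferentiableOn ℝ (fderiv ℝ v) (ball x₀ R) := hfv.differentiableOn one_ne_zero
  have hDv : ∀ x ∈ ball x₀ R, ‖fderiv ℝ v x‖ ≤ Bv := fun x hx => by
    rw [← norm_iteratedFDeriv_one]; exact hBv x hx 1 one_le_two
  have hD2v : ∀ x ∈ ball x₀ R, ‖fderiv ℝ (fderiv ℝ v) x‖ ≤ Bv := fun x hx =>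
    (norm_fderiv_fderiv_le_norm_iteratedFDeriv_two v x).trans (hBv x hx 2 le_rfl)
  have hHfv : HolderOnWith Bv α (fderiv ℝ (fderiv ℝ v)) (ball x₀ R) :=
    holderOnWith_fderiv_fderiv_of_iteratedFDeriv_two hHv
  -- the difference quotient
  set vq : E → ℝ := fun y => h⁻¹ • (v (y + h • e) - v y) with hvq
  have ha : ContDiffOn ℝ 2 vq (ball x₀ R') := contDiffOn_diffQuot hv hhe
  have hb : ∀ y ∈ ball x₀ R', ‖vq y‖ ≤ Bv := fun y hy => by
    simpa only [he, mul_one] using norm_diffQuot_le hvd hDv hhe hy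
  have hc : ∀ y ∈ ball x₀ R', fderiv ℝ vq y = h⁻¹ • (fderiv ℝ v (y + h • e) - fderiv ℝ v y) :=
    fun y hy => fderiv_diffQuot_of_mem_ball hvd hhe hy
  have hd : ∀ y ∈ ball x₀ R', ‖fderiv ℝ vq y‖ ≤ Bv := fun y hy => by
    rw [hc y hy]
    simpa only [he, mul_one] using norm_diffQuot_le (f := fderiv ℝ v) hfvd hD2v hhe hy
  have he' : HolderOnWith Bv α (fderiv ℝ vq) (ball x₀ R') := by
    have h1 := holderOnWith_diffQuot (f := fderiv ℝ v) hfvd hHfv hhe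
    rw [he1, mul_one] at h1
    exact holderOnWith_congr_on (fun y hy => (hc y hy).symm) h1
  have hg : HolderOnWith (Bv * (2 * R'.toNNReal) ^ (1 - (α : ℝ))) α vq (ball x₀ R') :=
    holderOnWith_of_norm_fderiv_le_ball hα1 (ha.differentiableOn two_ne_zero) hd
  have hlow : ∀ y ∈ ball x₀ R', ∀ j ≤ 1, ‖iteratedFDeriv ℝ j vq y‖ ≤ Bv := by
    intro y hy j hj
    rcases Nat.le_one_iff_eq_zero_or_eq_one.1 hj with rfl | rfl
    · rw [norm_iteratedFDeriv_zero]; exact hb y hy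
    · rw [norm_iteratedFDeriv_one]; exact hd y hy
  have hlowH : ∀ j ≤ 1, HolderOnWith (max (Bv * (2 * R'.toNNReal) ^ (1 - (α : ℝ))) Bv) α
      (iteratedFDeriv ℝ j vq) (ball x₀ R') := by
    intro j hj
    rcases Nat.le_one_iff_eq_zero_or_eq_one.1 hj with rfl | rfl
    · exact (holderOnWith_iteratedFDeriv_zero hg).mono_const (le_max_left _ _)
    · exact (holderOnWith_iteratedFDeriv_one_of_fderiv he').mono_const (le_max_right _ _)
  have htwo : HolderOnWith (‖h⁻¹‖₊ * (Bv + Bv)) α (iteratedFDeriv ℝ 2 vq) (ball x₀ R') := by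
    have hid : ∀ y ∈ ball x₀ R', iteratedFDeriv ℝ 2 vq y =
        h⁻¹ • (iteratedFDeriv ℝ 2 v (y + h • e) - iteratedFDeriv ℝ 2 v y) := fun y hy =>
      iteratedFDeriv_diffQuot (hv.contDiffAt (isOpen_ball.mem_nhds (ball_subset_ball hRR' hy)))
        (hv.contDiffAt (isOpen_ball.mem_nhds (add_mem_ball_of_norm_le hy hhe)))
    refine holderOnWith_congr_on (fun y hy => (hid y hy).symm) ?_
    exact holderOnWith_const_smul
      (holderOnWith_sub (holderOnWith_comp_add_ball hHv hhe) (hHv.mono (ball_subset_ball hRR')))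
      h⁻¹
  exact ⟨ha, hlow, hb, hd, he', fun y hy => norm_cjetOf_le bE 1 vq y (hlow y hy) Bv.coe_nonneg,
    holderOnWith_cjetOf bE 1 vq hlowH, htwo⟩

end DiffQuot

/-! ### The frozen functional -/

section Frozen

omit [DecidableEq ι] in
/-- **The frozen equation for the difference quotient.** If `H ∈ C¹`, `v ∈ C²(B(x₀, R))` and
`H(c(y), cjet₂ v(y)) = 0` on `B(x₀, R)`, then for `|h e| ≤ R - R'` and `y ∈ B(x₀, R')`,
`𝒜ₕ(y) (Δₕᵉ c (y), cjet₂ (Δₕᵉ v)(y)) = 0`, where `𝒜ₕ(y) = ∫₀¹ DH(w(y) + t(w(y + he) - w(y))) dt`,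
`w = (c, cjet₂ v)`: subtract the two equations (`sub_eq_segmentFDerivIntegral_apply`) and use
the linearity of the jet map (`cjetOf_diffQuot`). [folklore] -/
theorem frozen_equation (bE : OrthonormalBasis ι ℝ E) {H : P × CJet ι 2 → ℝ} {n : WithTop ℕ∞}
    (hH : ContDiff ℝ n H) (hn : 1 ≤ n) {c : E → P} {v : E → ℝ} {x₀ : E} {R R' h : ℝ}
    (hv : ContDiffOn ℝ 2 v (ball x₀ R))
    (heq : ∀ y ∈ ball x₀ R, H (c y, cjetOf bE 2 v y) = 0) {e : E} (hhe : ‖h • e‖ ≤ R - R')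
    {y : E} (hy : y ∈ ball x₀ R') :
    (∫ t in (0 : ℝ)..1, fderiv ℝ H ((c y, cjetOf bE 2 v y) +
        t • ((c (y + h • e), cjetOf bE 2 v (y + h • e)) - (c y, cjetOf bE 2 v y))))
      (h⁻¹ • (c (y + h • e) - c y), cjetOf bE 2 (fun y => h⁻¹ • (v (y + h • e) - v y)) y) = 0 := by
  have hRR' : R' ≤ R := sub_nonneg.1 ((norm_nonneg _).trans hhe)
  have hyR : y ∈ ball x₀ R := ball_subset_ball hRR' hy
  have hyeR : y + h • e ∈ ball x₀ R := add_mem_ball_of_norm_le hy hhe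
  have hsub := sub_eq_segmentFDerivIntegral_apply hH hn ((c y, cjetOf bE 2 v y) : P × CJet ι 2)
    (c (y + h • e), cjetOf bE 2 v (y + h • e))
  rw [heq y hyR, heq _ hyeR, sub_zero] at hsub
  rw [cjetOf_diffQuot bE (hv.contDiffAt (isOpen_ball.mem_nhds hyR))
    (hv.contDiffAt (isOpen_ball.mem_nhds hyeR)), ← Prod.smul_mk, ← Prod.mk_sub_mk, map_smul,
    ← hsub, smul_zero]

variable [FiniteDimensional ℝ P]

omit [DecidableEq ι] in
/-- **Uniform data of the frozen functional.** In the setting of the module docstring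
(`H ∈ C^∞`; `c ∈ C^{1,α}`, `v ∈ C^{2,α}` on `B(x₀, R)` with bounds `Bc`, `Bv`; ellipticity
`λ‖η‖² ≤ DH(p', J')(0, single₂ η⊗η)` for `(p', J')` within `δ` of `(c(y), cjet₂ v(y))`,
`y ∈ B(x₀, R)`), for `R' < R` and a unit vector `e` there are `M_A, K_A` and `h₁ ∈ (0, R - R']`
such that for `|h| < h₁`: `‖𝒜ₕ(y)‖ ≤ M_A` on `B(x₀, R')`, `y ↦ 𝒜ₕ(y)` is `(K_A, α)`-Hölder on
`B(x₀, R')`, and `λ‖η‖² ≤ 𝒜ₕ(y)(0, single₂ η⊗η)` (`𝒜` is bounded and Lipschitz on the compact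
convex box containing the data, the pair `(w(y), w(y + he))` is Hölder uniformly in `h`, and the
segment between two `δ`-close data points stays where `DH` is elliptic).
(Gilbarg–Trudinger 2001, §17.4, proof of Lemma 17.16.) [folklore] -/
theorem frozen_functional_data (bE : OrthonormalBasis ι ℝ E) {α : ℝ≥0} (hα : 0 < α) (hα1 : α ≤ 1)
    {H : P × CJet ι 2 → ℝ} (hH : ContDiff ℝ ∞ H) {c : E → P} {v : E → ℝ} {x₀ : E} {R : ℝ}
    {Bc Bv : ℝ≥0} (hc : ContDiffOn ℝ 1 c (ball x₀ R))
    (hBc : ∀ y ∈ ball x₀ R, ∀ j ≤ 1, ‖iteratedFDeriv ℝ j c y‖ ≤ Bc)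
    (hv : ContDiffOn ℝ 2 v (ball x₀ R))
    (hBv : ∀ y ∈ ball x₀ R, ∀ j ≤ 2, ‖iteratedFDeriv ℝ j v y‖ ≤ Bv)
    (hHv : HolderOnWith Bv α (iteratedFDeriv ℝ 2 v) (ball x₀ R)) {l δ : ℝ} (hδ : 0 < δ)
    (hell : ∀ y ∈ ball x₀ R, ∀ (p' : P) (J' : CJet ι 2), ‖p' - c y‖ < δ →
      ‖J' - cjetOf bE 2 v y‖ < δ → ∀ η : E →L[ℝ] ℝ, l * ‖η‖ ^ 2 ≤
        fderiv ℝ H (p', J') ((0 : P), Pi.single (Fin.last 2)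
          (fun I : Fin 2 → ι => η (bE (I 0)) * η (bE (I 1)))))
    {R' : ℝ} (hR' : R' < R) {e : E} (he : ‖e‖ = 1) :
    ∃ MA KA : ℝ≥0, ∃ h₁ : ℝ, 0 < h₁ ∧ h₁ ≤ R - R' ∧ ∀ h : ℝ, |h| < h₁ →
      (∀ y ∈ ball x₀ R', ‖∫ t in (0 : ℝ)..1, fderiv ℝ H ((c y, cjetOf bE 2 v y) +
          t • ((c (y + h • e), cjetOf bE 2 v (y + h • e)) - (c y, cjetOf bE 2 v y)))‖ ≤ MA) ∧
      HolderOnWith KA α (fun y => ∫ t in (0 : ℝ)..1, fderiv ℝ H ((c y, cjetOf bE 2 v y) +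
          t • ((c (y + h • e), cjetOf bE 2 v (y + h • e)) - (c y, cjetOf bE 2 v y))))
        (ball x₀ R') ∧
      ∀ y ∈ ball x₀ R', ∀ η : E →L[ℝ] ℝ, l * ‖η‖ ^ 2 ≤
        (∫ t in (0 : ℝ)..1, fderiv ℝ H ((c y, cjetOf bE 2 v y) +
          t • ((c (y + h • e), cjetOf bE 2 v (y + h • e)) - (c y, cjetOf bE 2 v y))))
          ((0 : P), Pi.single (Fin.last 2) (fun I : Fin 2 → ι => η (bE (I 0)) * η (bE (I 1)))) := by
  -- the data map and the box
  obtain ⟨hwH, hwK, hJH⟩ := dataMap_holder_mapsTo bE hα1 hc hBc hv hBv hHv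
  set Cw : ℝ≥0 := max (Bc * (2 * R.toNNReal) ^ (1 - (α : ℝ)))
    (max (Bv * (2 * R.toNNReal) ^ (1 - (α : ℝ))) Bv) with hCw
  set K : Set (P × CJet ι 2) := closedBall (0 : P) Bc ×ˢ closedBall (0 : CJet ι 2) Bv with hK
  have hKc : IsCompact (K ×ˢ K) :=
    ((isCompact_closedBall _ _).prod (isCompact_closedBall _ _)).prod
      ((isCompact_closedBall _ _).prod (isCompact_closedBall _ _))
  have hKconv : Convex ℝ (K ×ˢ K) :=
    ((convex_closedBall _ _).prod (convex_closedBall _ _)).prod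
      ((convex_closedBall _ _).prod (convex_closedBall _ _))
  obtain ⟨M, L, hM, hL⟩ := exists_bound_lipschitzOnWith_segmentFDerivIntegral hH hKc hKconv
  -- the smallness of `h`
  have hev : ∀ᶠ h in 𝓝 (0 : ℝ), (Bc : ℝ) * |h| < δ ∧ (Cw : ℝ) * |h| ^ (α : ℝ) < δ := by
    have h1 : Tendsto (fun h : ℝ => (Bc : ℝ) * |h|) (𝓝 0) (𝓝 0) := by
      have hcont : Continuous fun h : ℝ => (Bc : ℝ) * |h| := continuous_const.mul continuous_abs
      simpa using hcont.tendsto (0 : ℝ)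
    have h2 : Tendsto (fun h : ℝ => (Cw : ℝ) * |h| ^ (α : ℝ)) (𝓝 0) (𝓝 0) := by
      have hcont : Continuous fun h : ℝ => (Cw : ℝ) * |h| ^ (α : ℝ) :=
        continuous_const.mul ((Real.continuous_rpow_const α.coe_nonneg).comp continuous_abs)
      simpa [Real.zero_rpow (NNReal.coe_pos.2 hα).ne'] using hcont.tendsto (0 : ℝ)
    exact (h1.eventually (eventually_lt_nhds hδ)).and (h2.eventually (eventually_lt_nhds hδ))
  obtain ⟨ε, hε, hεh⟩ := Metric.eventually_nhds_iff.1 hev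
  refine ⟨M.toNNReal, L * Cw, min ε (R - R'), lt_min hε (sub_pos.2 hR'), min_le_right _ _,
    fun h hh => ?_⟩
  obtain ⟨hBch, hCwh⟩ : (Bc : ℝ) * |h| < δ ∧ (Cw : ℝ) * |h| ^ (α : ℝ) < δ :=
    hεh (by rw [dist_zero_right, Real.norm_eq_abs]; exact hh.trans_le (min_le_left _ _))
  have hhR : |h| ≤ R - R' := (hh.trans_le (min_le_right _ _)).le
  have hhe : ‖h • e‖ ≤ R - R' := by rwa [norm_smul, he, mul_one, Real.norm_eq_abs]
  have hRR' : R' ≤ R := hR'.le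
  -- the pair map `y ↦ (w(y), w(y + he))`
  set w : E → P × CJet ι 2 := fun y => (c y, cjetOf bE 2 v y) with hw
  have hpairH : HolderOnWith Cw α (fun y => (w y, w (y + h • e))) (ball x₀ R') := by
    have h2 : HolderOnWith Cw α (fun y => w (y + h • e)) (ball x₀ R') :=
      holderOnWith_comp_add_ball hwH hhe
    simpa only [max_self] using (hwH.mono (ball_subset_ball hRR')).prodMk h2
  have hpairK : MapsTo (fun y => (w y, w (y + h • e))) (ball x₀ R') (K ×ˢ K) := fun y hy =>
    ⟨hwK (ball_subset_ball hRR' hy), hwK (add_mem_ball_of_norm_le hy hhe)⟩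
  have h1top : (1 : WithTop ℕ∞) ≤ ∞ := by exact_mod_cast le_top
  -- `𝒜ₕ = 𝒜 ∘ pair` is Hölder (elaborated without expected type, then transported pointwise)
  have hAH := hL.comp_holderOnWith' hpairH hpairK
  refine ⟨fun y hy => (hM _ (hpairK hy)).trans (Real.le_coe_toNNReal M),
    holderOnWith_congr_on (fun y _ => ?_) hAH, fun y hy η => ?_⟩
  · simp only [Function.comp_apply, hw]
  -- ellipticity along the segment
  have hyR : y ∈ ball x₀ R := ball_subset_ball hRR' hy
  have hyeR : y + h • e ∈ ball x₀ R := add_mem_ball_of_norm_le hy hhe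
  refine le_segmentFDerivIntegral_apply hH h1top _ _ _ fun t ht => ?_
  rw [Prod.mk_sub_mk, Prod.smul_mk, Prod.mk_add_mk]
  have ht1 : |t| ≤ 1 := by rw [abs_of_nonneg ht.1]; exact ht.2
  refine hell y hyR _ _ ?_ ?_ η
  · rw [add_sub_cancel_left, norm_smul, Real.norm_eq_abs]
    have hcs : ‖c (y + h • e) - c y‖ ≤ Bc * |h| := by
      have h1 := norm_comp_add_sub_le (hc.differentiableOn one_ne_zero) (fun z hz => by
        rw [← norm_iteratedFDeriv_one]; exact hBc z hz 1 le_rfl) hhe hy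
      rwa [norm_smul, he, Real.norm_eq_abs, mul_one] at h1
    calc |t| * ‖c (y + h • e) - c y‖ ≤ 1 * (Bc * |h|) :=
          mul_le_mul ht1 hcs (norm_nonneg _) zero_le_one
      _ < δ := by rw [one_mul]; exact hBch
  · rw [add_sub_cancel_left, norm_smul, Real.norm_eq_abs]
    have hJ : ‖cjetOf bE 2 v (y + h • e) - cjetOf bE 2 v y‖ ≤ Cw * |h| ^ (α : ℝ) := by
      have hd := hJH.dist_le hyeR hyR
      rw [dist_eq_norm, dist_eq_norm, add_sub_cancel_left, norm_smul, he, mul_one,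
        Real.norm_eq_abs] at hd
      have hle : max (Bv * (2 * R.toNNReal) ^ (1 - (α : ℝ))) Bv ≤ Cw := le_max_right _ _
      exact hd.trans (mul_le_mul_of_nonneg_right (NNReal.coe_le_coe.2 hle) (by positivity))
    calc |t| * ‖cjetOf bE 2 v (y + h • e) - cjetOf bE 2 v y‖ ≤ 1 * (Cw * |h| ^ (α : ℝ)) :=
          mul_le_mul ht1 hJ (norm_nonneg _) zero_le_one
      _ < δ := by rw [one_mul]; exact hCwh

end Frozen

end UniformData

/-! ### The Schauder step, the limit, and the theorem -/

section Regularity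

variable {ι : Type*} [Fintype ι] [DecidableEq ι] {E : Type} [NormedAddCommGroup E]
  [InnerProductSpace ℝ E] [FiniteDimensional ℝ E] [MeasurableSpace E] [BorelSpace E] [Nontrivial E]
  {P : Type*} [NormedAddCommGroup P] [NormedSpace ℝ P] [FiniteDimensional ℝ P]

/-- **Uniform `C^{2,α}` bounds for the difference quotients** (the Schauder step). In the
setting of the module docstring, for `0 < ρ < R` and a basis direction `e_k` there are `B₂` and
`h₁ > 0` such that for every step `|h| < h₁` the difference quotient `v_h = Δₕ^{e_k} v` is `C²`
on `B(x₀, ρ)` with `‖Dʲ v_h‖ ≤ B₂` (`j ≤ 2`) and `[D² v_h]_{α; B(x₀, ρ)} ≤ B₂`: apply the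
interior Schauder estimate for `C^{2,α}` functions on `B(x₀, ρ) ⊂ B(x₀, (ρ + R)/2)` to the
frozen linear equation for `v_h`, whose data are bounded uniformly in `h`.
[cite: GilbargTrudinger2001, Lemma 17.16] -/
theorem diffQuot_schauder_bounds (bE : OrthonormalBasis ι ℝ E) {α : ℝ≥0} (hα : 0 < α)
    (hα1 : α < 1) {H : P × CJet ι 2 → ℝ} (hH : ContDiff ℝ ∞ H) {c : E → P} {v : E → ℝ}
    {x₀ : E} {R : ℝ} {Bc Bv : ℝ≥0} (hc : ContDiffOn ℝ 1 c (ball x₀ R))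
    (hBc : ∀ y ∈ ball x₀ R, ∀ j ≤ 1, ‖iteratedFDeriv ℝ j c y‖ ≤ Bc)
    (hHc : HolderOnWith Bc α (iteratedFDeriv ℝ 1 c) (ball x₀ R))
    (hv : ContDiffOn ℝ 2 v (ball x₀ R))
    (hBv : ∀ y ∈ ball x₀ R, ∀ j ≤ 2, ‖iteratedFDeriv ℝ j v y‖ ≤ Bv)
    (hHv : HolderOnWith Bv α (iteratedFDeriv ℝ 2 v) (ball x₀ R))
    (heq : ∀ y ∈ ball x₀ R, H (c y, cjetOf bE 2 v y) = 0) {l δ : ℝ} (hl : 0 < l) (hδ : 0 < δ)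
    (hell : ∀ y ∈ ball x₀ R, ∀ (p' : P) (J' : CJet ι 2), ‖p' - c y‖ < δ →
      ‖J' - cjetOf bE 2 v y‖ < δ → ∀ η : E →L[ℝ] ℝ, l * ‖η‖ ^ 2 ≤
        fderiv ℝ H (p', J') ((0 : P), Pi.single (Fin.last 2)
          (fun I : Fin 2 → ι => η (bE (I 0)) * η (bE (I 1)))))
    {ρ : ℝ} (hρ : 0 < ρ) (hρR : ρ < R) (k : ι) :
    ∃ B₂ : ℝ≥0, ∃ h₁ : ℝ, 0 < h₁ ∧ ∀ h : ℝ, |h| < h₁ →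
      ContDiffOn ℝ 2 (fun y => h⁻¹ • (v (y + h • bE k) - v y)) (ball x₀ ρ) ∧
      (∀ y ∈ ball x₀ ρ, ∀ j ≤ 2,
        ‖iteratedFDeriv ℝ j (fun y => h⁻¹ • (v (y + h • bE k) - v y)) y‖ ≤ B₂) ∧
      HolderOnWith B₂ α (iteratedFDeriv ℝ 2 (fun y => h⁻¹ • (v (y + h • bE k) - v y)))
        (ball x₀ ρ) := by
  have he : ‖bE k‖ = 1 := bE.orthonormal.1 k
  have h1top : (1 : WithTop ℕ∞) ≤ ∞ := by exact_mod_cast le_top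
  -- the intermediate radius
  set R' : ℝ := (ρ + R) / 2 with hR'
  have hρR' : ρ < R' := by rw [hR']; linarith
  have hR'R : R' < R := by rw [hR']; linarith
  -- uniform data of the frozen functional, and the Schauder constant
  obtain ⟨MA, KA, h₁, hh₁, hh₁R, hA⟩ :=
    frozen_functional_data bE hα hα1.le hH hc hBc hv hBv hHv hδ hell hR'R he
  obtain ⟨C, hC⟩ := exists_schauder_interior_ball_of_holder bE hα hα1 hl
    ((Fintype.card ι : ℝ) * MA) (max MA KA) x₀ hρ hρR'
  -- the constants of the lower-order data
  set C₁ : ℝ≥0 := max (Bv * (2 * R'.toNNReal) ^ (1 - (α : ℝ))) Bv with hC₁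
  set Nζ : ℝ≥0 := max Bc Bv with hNζ
  set Kζ : ℝ≥0 := max Bc C₁ with hKζ
  set B₁ : ℝ≥0 := MA * Nζ + (MA * Kζ + Nζ * KA) + Bv with hB₁
  have hB₁a : MA * Nζ ≤ B₁ := le_self_add.trans le_self_add
  have hB₁b : MA * Kζ + Nζ * KA ≤ B₁ := le_add_self.trans le_self_add
  have hB₁c : Bv ≤ B₁ := le_add_self
  refine ⟨max Bv (C * B₁), h₁, hh₁, fun h hh => ?_⟩
  have hhR : |h| ≤ R - R' := hh.le.trans hh₁R
  have hhe : ‖h • bE k‖ ≤ R - R' := by rwa [norm_smul, he, mul_one, Real.norm_eq_abs]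
  obtain ⟨hAM, hAH, hAell⟩ := hA h hh
  obtain ⟨hq2, hqlow, hq0, hq1, hq1H, hqjet, hqjetH, hq2H⟩ :=
    diffQuot_unknown_data bE hα1.le hv hBv hHv he hhR
  obtain ⟨hcq, hcqH, -⟩ := diffQuot_coeff_data hc hBc hHc he hhR
  -- the frozen equation: functional, coefficients, unknown, right-hand side
  set vq : E → ℝ := fun y => h⁻¹ • (v (y + h • bE k) - v y) with hvq
  set cq : E → P := fun y => h⁻¹ • (c (y + h • bE k) - c y) with hcq'
  set A : E → P × CJet ι 2 →L[ℝ] ℝ := fun y => ∫ t in (0 : ℝ)..1,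
    fderiv ℝ H ((c y, cjetOf bE 2 v y) +
      t • ((c (y + h • bE k), cjetOf bE 2 v (y + h • bE k)) - (c y, cjetOf bE 2 v y))) with hAd
  set a : ι → ι → E → ℝ := fun i j y =>
    symCoef (⇑(A y) ∘ Prod.snd) i j (0 : E × P × CJet ι 2) with had
  set f : E → ℝ := fun y => ∑ i, ∑ j, a i j y * iteratedFDeriv ℝ 2 vq y ![bE i, bE j] with hfd
  set ζ : E → P × CJet ι 2 := fun y => (cq y, jetPad ι 1 (cjetOf bE 1 vq y)) with hζd
  -- the right-hand side on the ball is `-A(ζ)`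
  have hfeq : ∀ y ∈ ball x₀ R', f y = -A y (ζ y) := fun y hy =>
    sum_symCoef_comp_snd_mul_iteratedFDeriv_two_eq bE (A y)
      (hq2.contDiffAt (isOpen_ball.mem_nhds hy)) (cq y)
      (frozen_equation bE hH h1top hv heq hhe hy) 0
  -- data of `ζ`
  have hζN : ∀ y ∈ ball x₀ R', ‖ζ y‖ ≤ Nζ := fun y hy => by
    rw [hζd, Prod.norm_def, hNζ, NNReal.coe_max]
    exact max_le_max (hcq y hy) ((norm_jetPad_le 1 _).trans (hqjet y hy))
  have hζH : HolderOnWith Kζ α ζ (ball x₀ R') :=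
    hcqH.prodMk (holderOnWith_of_norm_sub_le_norm_sub
      (fun x _ y _ => norm_jetPad_sub_le 1 _ _) hqjetH)
  -- data of `f`
  have hfN : ∀ y ∈ ball x₀ R', ‖f y‖ ≤ B₁ := fun y hy => by
    rw [hfeq y hy, norm_neg]
    calc ‖A y (ζ y)‖ ≤ ‖A y‖ * ‖ζ y‖ := (A y).le_opNorm _
      _ ≤ MA * Nζ := mul_le_mul (hAM y hy) (hζN y hy) (norm_nonneg _) MA.coe_nonneg
      _ ≤ B₁ := by exact_mod_cast hB₁a
  have hfH : HolderOnWith B₁ α f (ball x₀ R') :=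
    (holderOnWith_congr_on (fun y hy => (hfeq y hy).symm)
      (holderOnWith_neg (holderOnWith_clm_apply_of_bound hAH hζH hAM hζN))).mono_const hB₁b
  -- the coefficients
  have ha_symm : ∀ i j y, a i j y = a j i y := fun i j y => symCoef_comm _ i j _
  have ha_low : ∀ y ∈ ball x₀ R', ∀ ξ : ι → ℝ,
      l * ∑ i, ξ i ^ 2 ≤ ∑ i, ∑ j, a i j y * ξ i * ξ j := fun y hy ξ =>
    symCoef_comp_snd_lower bE (A y) 0 (hAell y hy) ξ
  have ha_up : ∀ y ∈ ball x₀ R', ∀ ξ : ι → ℝ,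
      ∑ i, ∑ j, a i j y * ξ i * ξ j ≤ (Fintype.card ι : ℝ) * MA * ∑ i, ξ i ^ 2 := fun y hy ξ =>
    (symCoef_comp_snd_upper (A y) 0 ξ).trans (mul_le_mul_of_nonneg_right
      (mul_le_mul_of_nonneg_left (hAM y hy) (Nat.cast_nonneg _))
      (Finset.sum_nonneg fun i _ => sq_nonneg _))
  have ha_bd : ∀ i j, ∀ y ∈ ball x₀ R', ‖a i j y‖ ≤ max MA KA := fun i j y hy =>
    ((norm_symCoef_comp_snd_le (A y) i j 0).trans (hAM y hy)).trans
      (NNReal.coe_le_coe.2 (le_max_left _ _))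
  have ha_H : ∀ i j, HolderOnWith (max MA KA) α (a i j) (ball x₀ R') := fun i j =>
    (holderOnWith_symCoef_comp_snd hAH i j 0).mono_const (le_max_right _ _)
  -- the interior Schauder estimate
  obtain ⟨hS1, hS2⟩ := hC a ha_symm ha_low ha_up ha_bd ha_H vq f B₁ (‖h⁻¹‖₊ * (Bv + Bv)) hq2
    hq2H (fun y _ => rfl) hfN hfH (fun y hy => (hq0 y hy).trans (NNReal.coe_le_coe.2 hB₁c))
    (fun y hy => (hq1 y hy).trans (NNReal.coe_le_coe.2 hB₁c)) (hq1H.mono_const hB₁c)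
  -- conclusion on `B(x₀, ρ)`
  refine ⟨hq2.mono (ball_subset_ball hρR'.le), fun y hy j hj => ?_,
    hS2.mono_const (le_max_right _ _)⟩
  rcases (show j ≤ 1 ∨ j = 2 by omega) with hj1 | rfl
  · exact (hqlow y (ball_subset_ball hρR'.le hy) j hj1).trans
      (NNReal.coe_le_coe.2 (le_max_left _ _))
  · exact (hS1 y hy).trans (by exact_mod_cast le_max_right Bv (C * B₁))

/-- **`C^{2,α}` bounds for the partial derivatives.** In the setting of the module docstring,
for `0 < ρ < R` every partial derivative `∂_k v = (y ↦ Dv(y) e_k)` is `C²` on `B(x₀, ρ)` with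
`‖Dʲ ∂_k v‖ ≤ B₂` (`j ≤ 2`) and `[D² ∂_k v]_{α; B(x₀, ρ)} ≤ B₂`: the difference quotients
`v_{hₙ}`, `hₙ = (n + N + 1)⁻¹ → 0`, are bounded in `C^{2,α}(B(x₀, ρ))`
(`diffQuot_schauder_bounds`) and converge pointwise to `∂_k v`, and uniform `C^{2,α}` bounds
pass to pointwise limits (`contDiffOn_ball_and_bounds_of_tendsto_of_holderOnWith`).
[cite: GilbargTrudinger2001, Lemma 17.16] -/
theorem holderTwo_fderiv_apply_basis (bE : OrthonormalBasis ι ℝ E) {α : ℝ≥0} (hα : 0 < α)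
    (hα1 : α < 1) {H : P × CJet ι 2 → ℝ} (hH : ContDiff ℝ ∞ H) {c : E → P} {v : E → ℝ}
    {x₀ : E} {R : ℝ} {Bc Bv : ℝ≥0} (hc : ContDiffOn ℝ 1 c (ball x₀ R))
    (hBc : ∀ y ∈ ball x₀ R, ∀ j ≤ 1, ‖iteratedFDeriv ℝ j c y‖ ≤ Bc)
    (hHc : HolderOnWith Bc α (iteratedFDeriv ℝ 1 c) (ball x₀ R))
    (hv : ContDiffOn ℝ 2 v (ball x₀ R))
    (hBv : ∀ y ∈ ball x₀ R, ∀ j ≤ 2, ‖iteratedFDeriv ℝ j v y‖ ≤ Bv)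
    (hHv : HolderOnWith Bv α (iteratedFDeriv ℝ 2 v) (ball x₀ R))
    (heq : ∀ y ∈ ball x₀ R, H (c y, cjetOf bE 2 v y) = 0) {l δ : ℝ} (hl : 0 < l) (hδ : 0 < δ)
    (hell : ∀ y ∈ ball x₀ R, ∀ (p' : P) (J' : CJet ι 2), ‖p' - c y‖ < δ →
      ‖J' - cjetOf bE 2 v y‖ < δ → ∀ η : E →L[ℝ] ℝ, l * ‖η‖ ^ 2 ≤
        fderiv ℝ H (p', J') ((0 : P), Pi.single (Fin.last 2)
          (fun I : Fin 2 → ι => η (bE (I 0)) * η (bE (I 1)))))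
    {ρ : ℝ} (hρ : 0 < ρ) (hρR : ρ < R) (k : ι) :
    ∃ B₂ : ℝ≥0, ContDiffOn ℝ 2 (fun y => fderiv ℝ v y (bE k)) (ball x₀ ρ) ∧
      (∀ y ∈ ball x₀ ρ, ∀ j ≤ 2, ‖iteratedFDeriv ℝ j (fun y => fderiv ℝ v y (bE k)) y‖ ≤ B₂) ∧
      HolderOnWith B₂ α (iteratedFDeriv ℝ 2 (fun y => fderiv ℝ v y (bE k))) (ball x₀ ρ) := by
  obtain ⟨B₂, h₁, hh₁, hB⟩ :=
    diffQuot_schauder_bounds bE hα hα1 hH hc hBc hHc hv hBv hHv heq hl hδ hell hρ hρR k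
  -- the sequence of steps `hₙ = (n + N + 1)⁻¹ < h₁`
  obtain ⟨N, hN⟩ := exists_nat_gt h₁⁻¹
  obtain ⟨hlim, hpos⟩ := tendsto_inv_nat_add_nhdsNE N
  have hsmall : ∀ n : ℕ, |((n : ℝ) + N + 1)⁻¹| < h₁ := fun n => by
    rw [abs_of_pos (hpos n).1]
    refine (hpos n).2.trans_lt ?_
    rw [inv_lt_comm₀ (by positivity) hh₁]
    linarith
  refine ⟨B₂, contDiffOn_ball_and_bounds_of_tendsto_of_holderOnWith (k := 2) hα
    (v := fun n y => (((n : ℝ) + N + 1)⁻¹)⁻¹ • (v (y + ((n : ℝ) + N + 1)⁻¹ • bE k) - v y))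
    (fun n => (hB _ (hsmall n)).1) (fun n => (hB _ (hsmall n)).2.1)
    (fun n => (hB _ (hsmall n)).2.2) fun y hy => ?_⟩
  have hyR : y ∈ ball x₀ R := ball_subset_ball hρR.le hy
  exact tendsto_diffQuot
    ((hv.contDiffAt (isOpen_ball.mem_nhds hyR)).differentiableAt two_ne_zero).hasFDerivAt
    (bE k) hlim

/-- **Difference-quotient regularity, `C^{2,α} ⇒ C^{3,α}`** (Gilbarg–Trudinger 2001, Lemma
17.16, first step of the regularity half). Let `H : P × CJet ι 2 → ℝ` be `C^∞`; let
`c ∈ C¹(B(x₀, R))` with `‖Dʲc‖ ≤ Bc` (`j ≤ 1`) and `[Dc]_α ≤ Bc`; let `v ∈ C²(B(x₀, R))` with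
`‖Dʲv‖ ≤ Bv` (`j ≤ 2`) and `[D²v]_α ≤ Bv` solve `H(c(y), cjet₂ v(y)) = 0` on `B(x₀, R)`
(`0 < α < 1`); and let `DH(p', J')` be `λ`-elliptic on the rank-one top-slot jets
`I ↦ η(e_{I 0}) η(e_{I 1})` whenever `(p', J')` is `δ`-close to `(c(y), cjet₂ v(y))` for some
`y ∈ B(x₀, R)`. Then for every `0 < ρ < R`, `v ∈ C³(B(x₀, ρ))` and there is `B'` with
`‖Dʲv‖ ≤ B'` (`j ≤ 3`) and `[D³v]_{α; B(x₀, ρ)} ≤ B'`.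
[cite: GilbargTrudinger2001, Lemma 17.16] -/
theorem contDiffOn_three_and_bounds_of_holderTwo_solution (bE : OrthonormalBasis ι ℝ E) {α : ℝ≥0}
    (hα : 0 < α) (hα1 : α < 1) {H : P × CJet ι 2 → ℝ} (hH : ContDiff ℝ ∞ H) {c : E → P}
    {v : E → ℝ} {x₀ : E} {R : ℝ} {Bc Bv : ℝ≥0} (hc : ContDiffOn ℝ 1 c (ball x₀ R))
    (hBc : ∀ y ∈ ball x₀ R, ∀ j ≤ 1, ‖iteratedFDeriv ℝ j c y‖ ≤ Bc)
    (hHc : HolderOnWith Bc α (iteratedFDeriv ℝ 1 c) (ball x₀ R))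
    (hv : ContDiffOn ℝ 2 v (ball x₀ R))
    (hBv : ∀ y ∈ ball x₀ R, ∀ j ≤ 2, ‖iteratedFDeriv ℝ j v y‖ ≤ Bv)
    (hHv : HolderOnWith Bv α (iteratedFDeriv ℝ 2 v) (ball x₀ R))
    (heq : ∀ y ∈ ball x₀ R, H (c y, cjetOf bE 2 v y) = 0) {l δ : ℝ} (hl : 0 < l) (hδ : 0 < δ)
    (hell : ∀ y ∈ ball x₀ R, ∀ (p' : P) (J' : CJet ι 2), ‖p' - c y‖ < δ →
      ‖J' - cjetOf bE 2 v y‖ < δ → ∀ η : E →L[ℝ] ℝ, l * ‖η‖ ^ 2 ≤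
        fderiv ℝ H (p', J') ((0 : P), Pi.single (Fin.last 2)
          (fun I : Fin 2 → ι => η (bE (I 0)) * η (bE (I 1)))))
    {ρ : ℝ} (hρ : 0 < ρ) (hρR : ρ < R) :
    ContDiffOn ℝ 3 v (ball x₀ ρ) ∧
      ∃ B' : ℝ≥0, (∀ y ∈ ball x₀ ρ, ∀ j ≤ 3, ‖iteratedFDeriv ℝ j v y‖ ≤ B') ∧
        HolderOnWith B' α (iteratedFDeriv ℝ 3 v) (ball x₀ ρ) := by
  choose B₂ hB₂ using fun k =>
    holderTwo_fderiv_apply_basis bE hα hα1 hH hc hBc hHc hv hBv hHv heq hl hδ hell hρ hρR k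
  set B : ℝ≥0 := ∑ k, B₂ k with hB
  have hBk : ∀ k, B₂ k ≤ B := fun k =>
    Finset.single_le_sum (f := B₂) (fun _ _ => zero_le) (Finset.mem_univ k)
  obtain ⟨h3, hbd, hH3⟩ := contDiffOn_succ_and_bounds_of_partials (n := 2) bE
    ((hv.differentiableOn two_ne_zero).mono (ball_subset_ball hρR.le)) (fun k => (hB₂ k).1)
    (fun k y hy j hj => ((hB₂ k).2.1 y hy j hj).trans (NNReal.coe_le_coe.2 (hBk k)))
    (fun k => (hB₂ k).2.2.mono_const (hBk k))
  refine ⟨h3, max Bv ((Fintype.card ι) ^ 3 * B), fun y hy j hj => ?_, hH3.mono_const ?_⟩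
  · rcases (show j ≤ 2 ∨ j = 3 by omega) with hj2 | rfl
    · exact (hBv y (ball_subset_ball hρR.le hy) j hj2).trans (NNReal.coe_le_coe.2 (le_max_left _ _))
    · exact (hbd y hy 2 le_rfl).trans (by push_cast; exact le_max_right _ _)
  · exact le_max_right _ _

end Regularity

end Literature.Analysis.PDE
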